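import Summits.BirchSwinnertonDyer.Rank1Residual.Additive.RamifiedSevenGenusKatoSideLevelIdentity
import Summits.BirchSwinnertonDyer.Rank1Residual.Additive.RamifiedSevenGenusSinnottNorm
import Literature.NumberTheory.ComplexMultiplication.EllipticUnits.NormOverDescent
import Literature.NumberTheory.ComplexMultiplication.EllipticUnits.KatoUnitRepGlobalUnitSqrtNegSeven
import Literature.NumberTheory.ComplexMultiplication.EllipticUnits.KatoEllipticUnitRepresentatives
import HarnessLib

set_option autoImplicit false

/-!
# `𝒞₇` genus road (crux `EllipticUnitValueSevenOfGZK`, K7r), row K2C-15: THE NORMED ELLIPTIC UNIT FAMILY OF A FRAME —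
# `exists_normedEllipticUnitFamily_of_reps` (the value pin `IsNormedEllipticUnitFamily F θu` INHABITED from given Kato
# representatives, with the reading `θu n = e(N_{K(7^{n+1}𝔣)/e⁻¹F′ₙ}(zₙ))` exported) and its `hE` corollary

Cell bsd-cm, seat bsd-cm-prr-ty1 g36 (literature-prover); row card `bsd-cm-plan/g37/SUMMON-typers-K2C-13-16.md` (K2C-15), README of
record `bsd-cm-prr-ty1/g35/README-successor.md` (375cdf468ea8f8b1), pen rulings D1053 (2) («REPS AS PARAMETERS»: the K2C-16
constructor feeds the SAME level representatives to the genus side `θu` and — one `𝔭`-step down the ray-class tower, see the sequel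
`RamifiedSevenGenusThetaRepCoherence.lean` — to the Kummer unit tower of F∃-2b) and D1089 (T7-B2′).  THEOREMS ONLY (no `def`, no
named fact, no `instance`, no notation, no `sorry`); CONDITIONAL on the displayed named facts Kato §15.5 (1) «`_𝔞z_𝔪` is a unit when
`𝔪` has two prime divisors» (`Kato2004.kato155_isUnit_of_two_le_primeDivisors`) and — in the `hE` form only — Kato §15.5 existence
(`Kato2004.sec155_exists_katoUnitRep`).

WHAT.  For an abstract `𝒞₇` genus frame `F` (`RamifiedSevenGenusFactorisationShape.lean`), a number field `K` of degree `2` with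
`s ∈ O_K`, `s² = −7`, a complex embedding `ι`, ANY identification `e : K̄ →+* ℚ̄` of algebraic closures, the conductor
`𝔣 := (s)·(|D|)` (norm `7|D|²`, `𝔣 ∣ (7D)`), an admissible twist `𝔞` (`IsTwist 7 𝔣 𝔞`) and level representatives `z n` of Kato's
elliptic units `_𝔞z_{7^{n+1}𝔣}` (`IsKatoUnitRep 7 ι 𝔣 (n+1) 𝔞 (z n)`):
* §1 `not_seven_dvd_d` (with the tree's `GenusFrame.two_le_d`) and the conductor bookkeeping of `𝔣 = (s)·(|D|)` (`absNorm_span_sqrt_mul_span_d`,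
  `span_sqrt_mul_span_d_dvd`, `span_sqrt_mul_span_d_ne_bot`);
* §2 [G3] THE LAYER INCLUSION `F′ₙ ⊆ e(K(𝔪))` for every modulus `𝔪 ≠ 0` with `𝔪 ⊆ (7^{n+1}|D|)` — `F′ₙ ⊆ ℚ(ζsys n) = ℚ[ζsys n]`
  (`GenusFrame.layer_le_adjoin_ζsys`) and `ζsys n = e ζ` for an aligned primitive root `ζ ∈ K(𝔪)`
  (`exists_isPrimitiveRoot_rayClassField_map_eq`), so `y = q(ζsys n) = e(q(ζ))` — in particular for `𝔪 = 7^{n+1}𝔣`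
  (`GenusFrame.exists_mem_katoLayer_apply_eq`: the layer clause of the pin VERBATIM);
* §3 ★ `exists_normedEllipticUnitFamily_of_reps` — D1053 (2)'s header: `∃ θu, IsNormedEllipticUnitFamily F θu ∧ ∀ n, θu n =
  e(N_{K(7^{n+1}𝔣)/e⁻¹F′ₙ}(z n))` (`θu n` := the product of the conjugates of `z n` under the stabiliser of `e⁻¹F′ₙ`, a GLOBAL unit of
  `F′ₙ` by `NormDescent.exists_globalUnit_eq_map_finprod_fixing` since `z n` is a global unit —
  `KatoUnitRepGlobalUnit.mem_globalUnitsOf_of_isKatoUnitRep_sqrtNegSeven`, Kato §15.5 (1));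
* §4 `exists_normedEllipticUnitFamily` — the `hE` COROLLARY (representatives chosen from Kato §15.5 at the rigid levels
  `7^{n+1}𝔣`, `unitsInjectiveMod_katoModulus`).

HONEST LABEL: the pin is INHABITED conditionally on two displayed print facts; nothing about the VALUES of Kato's units beyond their
definition is asserted; no stub closes; stmt-BirchSwinnertonDyer-19945 is OPEN; `X12.CMRamifiedSeven` is NOT proved; no summit statement
is proved by this seat; BSD is claimed for no curve.

## References
* K. Kato, Astérisque 295 (2004), §15.5 (p. 253: `_𝔞z_𝔣 ∈ K(𝔣)^×`; (1) p. 254: «a unit if 𝔣 has at least two prime divisors»),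
  §15.14 (p. 264: `F′_n ⊂ K(7^{n+1}𝔣)`). [Kato2004Asterisque]
* E. de Shalit, *Iwasawa Theory of Elliptic Curves with Complex Multiplication* (1987), II.2.4 (i)(iii), II.2.5 (i). [deShalit1987]
* J. Neukirch, *Algebraic Number Theory* (1999), Ch. VI §6 Prop. (6.7) (`K(μ_m) ⊆ K^𝔪` for `𝔪 ⊆ (m)`), Ch. IV §1. [NeukirchANT1999]
* T. Tsuji, J. Number Theory 78 (1999), §3 (p. 5: `K_n = F(μ_{p^{n+1}})`), §6 (p. 20). [Tsuji1999]
* Tree: `RamifiedSevenGenusKatoShapes.lean` §1 (the pin), `RamifiedSevenGenusNormedFamilyFields.lean` (`apply_algebraMap_mem_layer`,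
  `preimageField`, `galOver_preimageField`, `unitsInjectiveMod_katoModulus`), `RamifiedSevenGenusKatoSideLevelIdentity.lean`
  (`absNorm_span_sqrt`, `coe_family_eq_map_normOver`), `RamifiedSevenGenusSinnottNorm.lean` (`layer_le_adjoin_ζsys`),
  `EllipticUnits/NormOverDescent.lean` (p809295), `EllipticUnits/KatoUnitRepGlobalUnitSqrtNegSeven.lean` (p809993).
-/

noncomputable section

open scoped NumberField
open Polynomial IsDedekindDomain NumberField
open Literature.NumberTheory.IwasawaTheory
open Literature.NumberTheory.NumberFields (rayClassField)
open Literature.NumberTheory.EllipticCurves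
open Literature.NumberTheory.ComplexMultiplication.EllipticUnits

namespace Summit.BirchSwinnertonDyer.Rank1Residual.Additive.GenusSeven

variable {K : Type} [Field K] [NumberField K]

/-! ## §1 The frame's `7 ∤ |D|` and the conductor `𝔣 = (s)·(|D|)` -/

namespace GenusFrame

variable (F : GenusFrame)

/-- `7 ∤ |D|`. [cite: Tsuji1999, §3 Thm 3.1 (p. 6, «(p, m) = 1»)] -/
theorem not_seven_dvd_d : ¬ 7 ∣ F.d := fun h =>
  absurd (Nat.Coprime.eq_one_of_dvd F.d_coprime_seven.symm h) (by norm_num)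

end GenusFrame

section Conductor

omit [NumberField K] in
/-- `s² = −7` read in `O_K`. [cite: NeukirchANT1999, Ch. I §8] -/
theorem sq_eq_neg_seven_ringOfIntegers {s : 𝓞 K} (hs : (s : K) ^ 2 = -7) : s ^ 2 = -7 :=
  RingOfIntegers.eq_iff.mp (by push_cast; exact hs)

/-- **`N((s)·(d)) = 7·d²`** (`[K : ℚ] = 2`, `s² = −7`). [cite: Kato2004Asterisque, §15.8 (p. 257, «𝔣 = cond ψ»)] [cite: NeukirchANT1999, Ch. I §8] -/
theorem absNorm_span_sqrt_mul_span_natCast (h2 : Module.finrank ℚ K = 2) (s : 𝓞 K) (hs : (s : K) ^ 2 = -7) (d : ℕ) :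
    Ideal.absNorm (Ideal.span {s} * Ideal.span {((d : ℕ) : 𝓞 K)}) = 7 * d ^ 2 := by
  rw [map_mul, absNorm_span_sqrt h2 s (sq_eq_neg_seven_ringOfIntegers hs), absNorm_span_natCast h2]

omit [NumberField K] in
/-- `(D) = (|D|)` in `O_K` (= `CubicSieve.span_intCast_eq_span_natAbs` of `Sieve/HeathBrownCubicLemma51.lean`, re-proved privately —
as in `RamifiedSevenGenusKatoSideLevelIdentity.lean` — rather than importing the cubic-sieve file). [cite: NeukirchANT1999, Ch. I §3 (the unit −1)] -/
private theorem span_intCast_eq_span_natAbs' (D : ℤ) : Ideal.span {(D : 𝓞 K)} = Ideal.span {((D.natAbs : ℕ) : 𝓞 K)} := by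
  rcases Int.natAbs_eq D with h | h
  · conv_lhs => rw [h]
    rw [Int.cast_natCast]
  · conv_lhs => rw [h]
    rw [Int.cast_neg, Int.cast_natCast, Ideal.span_singleton_neg]

omit [NumberField K] in
/-- **`(s)·(|D|) ∣ (7D)`** (`(7D) = (s)²·(|D|)`). [cite: Kato2004Asterisque, §15.8 (p. 257, «cond ψ ∣ 𝔣»)] -/
theorem span_sqrt_mul_span_natAbs_dvd (s : 𝓞 K) (hs : (s : K) ^ 2 = -7) (D : ℤ) :
    Ideal.span {s} * Ideal.span {((D.natAbs : ℕ) : 𝓞 K)} ∣ Ideal.span {((7 * D : ℤ) : 𝓞 K)} := by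
  have hfact : Ideal.span {((7 * D : ℤ) : 𝓞 K)} = Ideal.span {s} ^ 2 * Ideal.span {((D.natAbs : ℕ) : 𝓞 K)} := by
    rw [Int.cast_mul, ← Ideal.span_singleton_mul_span_singleton, Int.cast_ofNat,
      span_seven_eq_span_sqrt_sq s (sq_eq_neg_seven_ringOfIntegers hs), span_intCast_eq_span_natAbs']
  rw [hfact, sq, mul_assoc]
  exact Dvd.intro_left _ rfl

/-- `(s)·(d) ≠ 0` for `d ≠ 0`. [cite: Kato2004Asterisque, §15.5 (p. 253)] -/
theorem span_sqrt_mul_span_natCast_ne_bot (h2 : Module.finrank ℚ K = 2) (s : 𝓞 K) (hs : (s : K) ^ 2 = -7) {d : ℕ}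
    (hd : d ≠ 0) : Ideal.span {s} * Ideal.span {((d : ℕ) : 𝓞 K)} ≠ ⊥ := by
  intro h
  have h1 := absNorm_span_sqrt_mul_span_natCast h2 s hs d
  rw [h, Ideal.absNorm_bot] at h1
  exact absurd h1.symm (Nat.mul_ne_zero (by norm_num) (pow_ne_zero 2 hd))

end Conductor

/-! ## §2 [G3] The layer inclusion `F′ₙ ⊆ e(K(𝔪))` for `𝔪 ≠ 0`, `𝔪 ⊆ (7^{n+1}|D|)`; in particular `F′ₙ ⊆ e(K(7^{n+1}𝔣))` -/

namespace GenusFrame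

variable (F : GenusFrame)

/-- **[G3] `F′ₙ ⊆ e(K(𝔪))`** for a totally complex `K`, any ring map `e : K̄ → ℚ̄`, and any modulus `𝔪 ≠ 0` with
`𝔪 ⊆ (7^{n+1}|D|)`: every `y ∈ F′ₙ = F₀(μ_{7^{n+1}}) ⊆ ℚ(ζsys n)` is `q(ζsys n)` for a `ℚ`-polynomial `q`, and `ζsys n = e ζ` for
a primitive `7^{n+1}|D|`-th root `ζ ∈ K(𝔪)` (`K(μ_m) ⊆ K(𝔪)` for `𝔪 ⊆ (m)`), so `y = e(q(ζ))` with `q(ζ) ∈ K(𝔪)`.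
[cite: NeukirchANT1999, Ch. VI §6 Prop. (6.7) (proof) p. 399] [cite: Kato2004Asterisque, §15.14 (p. 264, «F′_n ⊂ K(7^{n+1}𝔣)»)]
[cite: Tsuji1999, §6 (p. 20, «k ⊆ ℚ(μ_t)»)] -/
theorem exists_mem_rayClassField_apply_eq [IsTotallyComplex K] (e : AlgebraicClosure K →+* AlgebraicClosure ℚ)
    {𝔪 : Ideal (𝓞 K)} (h𝔪0 : 𝔪 ≠ ⊥) (n : ℕ) (h𝔪 : 𝔪 ≤ Ideal.span {((7 ^ (n + 1) * F.d : ℕ) : 𝓞 K)})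
    (y : AlgebraicClosure ℚ) (hy : y ∈ F.layer n) :
    ∃ x : AlgebraicClosure K, x ∈ rayClassField K 𝔪 ∧ e x = y := by
  haveI : NeZero (7 ^ (n + 1) * F.d) := ⟨mul_ne_zero (pow_ne_zero _ (by norm_num)) F.d_ne_zero⟩
  -- the aligned root `ζ ∈ K(𝔪)`, `e ζ = ζsys n`
  obtain ⟨ζ, -, heζ⟩ := exists_isPrimitiveRoot_rayClassField_map_eq h𝔪0 h𝔪 e (F.isPrimitiveRoot_ζsys n)
  -- `y = q(ζsys n)`
  have halg : IsAlgebraic ℚ (F.ζsys n) := isAlgebraic_iff_isIntegral.mpr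
    (IsIntegral.of_pow (NeZero.pos (7 ^ (n + 1) * F.d)) (by rw [(F.isPrimitiveRoot_ζsys n).pow_eq_one]; exact isIntegral_one))
  have hmem : y ∈ (IntermediateField.adjoin ℚ {F.ζsys n}).toSubalgebra := F.layer_le_adjoin_ζsys n hy
  rw [IntermediateField.adjoin_simple_toSubalgebra_of_isAlgebraic halg, Algebra.adjoin_singleton_eq_range_aeval] at hmem
  obtain ⟨q, hq⟩ := hmem
  refine ⟨((aeval ζ q : rayClassField K 𝔪) : AlgebraicClosure K), (aeval ζ q).2, ?_⟩
  -- ring homomorphisms commute with the evaluation of `ℚ`-polynomials (`ℚ →+* ℚ̄` is unique)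
  have h1 := hom_eval₂ q (algebraMap ℚ (rayClassField K 𝔪))
    (e.comp (algebraMap (rayClassField K 𝔪) (AlgebraicClosure K))) ζ
  rw [RingHom.comp_apply, RingHom.comp_apply, IntermediateField.algebraMap_apply, IntermediateField.algebraMap_apply, heζ,
    RingHom.ext_rat ((e.comp (algebraMap (rayClassField K 𝔪) (AlgebraicClosure K))).comp (algebraMap ℚ (rayClassField K 𝔪)))
      (algebraMap ℚ (AlgebraicClosure ℚ))] at h1
  rw [← hq]
  change e _ = aeval (F.ζsys n) q
  rw [aeval_def, aeval_def]
  exact h1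

/-- **[G3] at Kato's level `7^{n+1}𝔣`** — THE LAYER CLAUSE OF THE PIN `IsNormedEllipticUnitFamily` VERBATIM: for `[K : ℚ] = 2`,
`x² = −7` (so `K` is totally complex), `N𝔣 = 7|D|²`, `𝔣 ∣ (7D)` (so `𝔣 ⊆ (|D|)`, `7^{n+1}𝔣 ⊆ (7^{n+1}|D|)`):
`∀ y ∈ F′ₙ, ∃ x ∈ K(7^{n+1}𝔣), e x = y`. [cite: Kato2004Asterisque, §15.14 (p. 264, «F′_n ⊂ K(7^{n+1}𝔣)»)]
[cite: NeukirchANT1999, Ch. VI §6 Prop. (6.7) (proof) p. 399] -/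
theorem exists_mem_katoLayer_apply_eq (hK2 : Module.finrank ℚ K = 2) {x : K} (hx : x ^ 2 = -7)
    (e : AlgebraicClosure K →+* AlgebraicClosure ℚ) {𝔣 : Ideal (𝓞 K)} (hN𝔣 : Ideal.absNorm 𝔣 = 7 * F.d ^ 2)
    (h𝔣D : 𝔣 ∣ Ideal.span {((7 * F.D : ℤ) : 𝓞 K)}) (n : ℕ) (y : AlgebraicClosure ℚ) (hy : y ∈ F.layer n) :
    ∃ z : AlgebraicClosure K, z ∈ katoLayer 7 𝔣 (n + 1) ∧ e z = y := by
  haveI : IsTotallyComplex K := isTotallyComplex_of_sq_eq_neg_seven hx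
  exact F.exists_mem_rayClassField_apply_eq e (katoModulus_ne_bot 7 𝔣 (conductor_ne_bot F.D_neg.ne hN𝔣) (n + 1)) n
    (katoModulus_succ_le_span 7 𝔣 F.d (conductor_le_span_d hK2 hx F.D_neg.ne hN𝔣 h𝔣D) n) y hy

end GenusFrame

/-! ## §3 ★ The normed family from GIVEN representatives (D1053 (2): reps as parameters) -/

/-- ★ **`exists_normedEllipticUnitFamily_of_reps` — THE VALUE PIN INHABITED FROM GIVEN REPRESENTATIVES, WITH ITS READING.**
For a `𝒞₇` genus frame `F`, `[K : ℚ] = 2` with `s ∈ O_K`, `s² = −7`, `ι : K → ℂ`, an identification `e : K̄ → ℚ̄`, the conductor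
`𝔣 = (s)·(|D|)`, an admissible twist `𝔞` of norm `F.normA`, and representatives `z n` of `_𝔞z_{7^{n+1}𝔣}` (`IsKatoUnitRep`): the
family `θu n := e(∏_{τ ∈ Gal(K(7^{n+1}𝔣)/K), τ|_{e⁻¹F′ₙ} = id} τ(z n))` consists of GLOBAL UNITS of `F′ₙ` (Kato §15.5 (1): `z n` is a
unit since `7^{n+1}𝔣` has the two prime divisors `(s)`, `𝔮 ∣ |D|`; Galois descent `NormDescent.exists_globalUnit_eq_map_finprod_fixing`),
SATISFIES the pin `IsNormedEllipticUnitFamily F θu` (witnesses `K, s, ι, e, 𝔣, 𝔞, z`; layer clause §2), AND reads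
`θu n = e(N_{K(7^{n+1}𝔣)/Mₙ}(z n))`, `Mₙ = e⁻¹(F′ₙ)` (`normOver … (preimageField e (F.layer n) _)`) — the conjunct through which the
K2C-16 constructor ties `θu` to the Kummer unit tower built from the same representatives (sequel file).
[cite: Kato2004Asterisque, §15.5 (p. 253) and 15.5 (1) (p. 254), §15.14 (p. 264)] [cite: deShalit1987, II.2.4 Proposition (iii), II.2.5 Proposition (i)] -/
theorem exists_normedEllipticUnitFamily_of_reps (F : GenusFrame) (K : Type) [Field K] [NumberField K]
    (h2 : Module.finrank ℚ K = 2) (s : 𝓞 K) (hs : (s : K) ^ 2 = -7) (ι : K →+* ℂ)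
    (e : AlgebraicClosure K →+* AlgebraicClosure ℚ) (𝔞 : Ideal (𝓞 K))
    (h𝔞 : IsTwist 7 (Ideal.span {s} * Ideal.span {((F.d : ℕ) : 𝓞 K)}) 𝔞) (hN𝔞 : Ideal.absNorm 𝔞 = F.normA)
    (z : ℕ → (AlgebraicClosure K)ˣ)
    (hz : ∀ n : ℕ, IsKatoUnitRep 7 ι (Ideal.span {s} * Ideal.span {((F.d : ℕ) : 𝓞 K)}) (n + 1) 𝔞 (z n))
    (h155u : Kato2004.kato155_isUnit_of_two_le_primeDivisors) :
    ∃ θu : ∀ n : ℕ, globalUnitsOf (F.layer n), IsNormedEllipticUnitFamily F θu ∧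
      ∀ n : ℕ, (((θu n : globalUnitsOf (F.layer n)) : (AlgebraicClosure ℚ)ˣ) : AlgebraicClosure ℚ) =
        e ((normOver (katoLayer 7 (Ideal.span {s} * Ideal.span {((F.d : ℕ) : 𝓞 K)}) (n + 1))
            (preimageField e (F.layer n) (fun k => GenusFrame.apply_algebraMap_mem_layer h2 hs e n k))
            ⟨(z n : AlgebraicClosure K), (hz n).1.1⟩ :
              katoLayer 7 (Ideal.span {s} * Ideal.span {((F.d : ℕ) : 𝓞 K)}) (n + 1)) : AlgebraicClosure K) := by
  haveI : Fact (Nat.Prime 7) := ⟨Nat.prime_seven⟩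
  set 𝔣 : Ideal (𝓞 K) := Ideal.span {s} * Ideal.span {((F.d : ℕ) : 𝓞 K)} with h𝔣def
  have hK : ∀ (n : ℕ) (k : K), e (algebraMap K (AlgebraicClosure K) k) ∈ F.layer n :=
    fun n k => GenusFrame.apply_algebraMap_mem_layer h2 hs e n k
  have hN𝔣 : Ideal.absNorm 𝔣 = 7 * F.d ^ 2 := absNorm_span_sqrt_mul_span_natCast h2 s hs F.d
  have h𝔣D : 𝔣 ∣ Ideal.span {((7 * F.D : ℤ) : 𝓞 K)} := span_sqrt_mul_span_natAbs_dvd s hs F.D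
  -- `z n` is a global unit of `K(7^{n+1}𝔣)` (Kato §15.5 (1))
  have hglob : ∀ n : ℕ, z n ∈ globalUnitsOf (katoLayer 7 𝔣 (n + 1)) := fun n =>
    KatoUnitRepGlobalUnit.mem_globalUnitsOf_of_isKatoUnitRep_sqrtNegSeven h155u h2 s hs ι F.two_le_d F.not_seven_dvd_d
      h𝔣def (n + 1) h𝔞 (hz n)
  -- the normed unit, a global unit of `F′ₙ`
  have hex : ∀ n : ℕ, ∃ u ∈ globalUnitsOf (F.layer n), (u : AlgebraicClosure ℚ) =
      e (((∏ᶠ τ ∈ {τ : katoLayer 7 𝔣 (n + 1) ≃ₐ[K] katoLayer 7 𝔣 (n + 1) |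
          ∀ x : katoLayer 7 𝔣 (n + 1), e (x : AlgebraicClosure K) ∈ F.layer n → τ x = x},
            τ ⟨(z n : AlgebraicClosure K), (hz n).1.1⟩ : katoLayer 7 𝔣 (n + 1)) : AlgebraicClosure K)) := fun n =>
    NormDescent.exists_globalUnit_eq_map_finprod_fixing 7 𝔣 (n + 1) e (F.layer n) (hK n) (hglob n).1
      (by simpa only [Units.val_inv_eq_inv_val] using (hglob n).2.1) (z n).ne_zero
  choose u hu huz using hex
  -- the finite stabiliser and the product pushed through `e`
  have hread : ∀ n : ℕ, ((u n : (AlgebraicClosure ℚ)ˣ) : AlgebraicClosure ℚ) =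
      ∏ᶠ τ ∈ {τ : katoLayer 7 𝔣 (n + 1) ≃ₐ[K] katoLayer 7 𝔣 (n + 1) |
          ∀ x : katoLayer 7 𝔣 (n + 1), e (x : AlgebraicClosure K) ∈ F.layer n → τ x = x},
        e ((τ ⟨((z n : (AlgebraicClosure K)ˣ) : AlgebraicClosure K), (hz n).1.1⟩ : katoLayer 7 𝔣 (n + 1)) :
          AlgebraicClosure K) := by
    intro n
    rw [huz n]
    exact MonoidHom.map_finprod_mem
      (fun σ : katoLayer 7 𝔣 (n + 1) ≃ₐ[K] katoLayer 7 𝔣 (n + 1) =>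
        σ (⟨(z n : AlgebraicClosure K), (hz n).1.1⟩ : katoLayer 7 𝔣 (n + 1)))
      (e.toMonoidHom.comp ((algebraMap (katoLayer 7 𝔣 (n + 1)) (AlgebraicClosure K)).toMonoidHom)) (Set.toFinite _)
  refine ⟨fun n => ⟨u n, hu n⟩, ⟨K, inferInstance, inferInstance, (s : K), ι, e, 𝔣, 𝔞, z, hz, h2, hs, hN𝔣, h𝔣D, h𝔞, hN𝔞,
    fun n y hy => F.exists_mem_katoLayer_apply_eq h2 hs e hN𝔣 h𝔣D n y hy, hread⟩, fun n => ?_⟩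
  rw [normOver, galOver_preimageField]
  exact huz n

/-! ## §4 The `hE` corollary: representatives chosen from Kato §15.5 -/

/-- **`exists_normedEllipticUnitFamily` — the pin inhabited from Kato §15.5** (`hE`: a representative of `_𝔞z_{7^{n+1}𝔣}` exists at
every rigid level; every level `7^{n+1}𝔣` is rigid for `K ∋ √−7`, `unitsInjectiveMod_katoModulus`) **and §15.5 (1)** (`h155u`), for a
frame `F`, `[K : ℚ] = 2`, `s² = −7`, `ι`, `e`, and an admissible twist `𝔞` of `𝔣 = (s)·(|D|)` of norm `F.normA`.
[cite: Kato2004Asterisque, §15.5 (p. 253) and 15.5 (1) (p. 254)] [cite: deShalit1987, II.2.4 Proposition (iii)] -/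
theorem exists_normedEllipticUnitFamily (F : GenusFrame) (K : Type) [Field K] [NumberField K]
    (h2 : Module.finrank ℚ K = 2) (s : 𝓞 K) (hs : (s : K) ^ 2 = -7) (ι : K →+* ℂ)
    (e : AlgebraicClosure K →+* AlgebraicClosure ℚ) (𝔞 : Ideal (𝓞 K))
    (h𝔞 : IsTwist 7 (Ideal.span {s} * Ideal.span {((F.d : ℕ) : 𝓞 K)}) 𝔞) (hN𝔞 : Ideal.absNorm 𝔞 = F.normA)
    (hE : Kato2004.sec155_exists_katoUnitRep) (h155u : Kato2004.kato155_isUnit_of_two_le_primeDivisors) :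
    ∃ θu : ∀ n : ℕ, globalUnitsOf (F.layer n), IsNormedEllipticUnitFamily F θu := by
  haveI : Fact (Nat.Prime 7) := ⟨Nat.prime_seven⟩
  set 𝔣 : Ideal (𝓞 K) := Ideal.span {s} * Ideal.span {((F.d : ℕ) : 𝓞 K)} with h𝔣def
  have hN𝔣 : Ideal.absNorm 𝔣 = 7 * F.d ^ 2 := absNorm_span_sqrt_mul_span_natCast h2 s hs F.d
  have h𝔣0 : 𝔣 ≠ ⊥ := span_sqrt_mul_span_natCast_ne_bot h2 s hs F.d_ne_zero
  have hex : ∀ n : ℕ, ∃ v : (AlgebraicClosure K)ˣ, IsKatoUnitRep 7 ι 𝔣 (n + 1) 𝔞 v := fun n =>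
    hE.exists_rep (isImaginaryQuadratic_of_sq h2 hs) ι h𝔣0 (by omega) (unitsInjectiveMod_katoModulus h2 hs hN𝔣 (n + 1)) h𝔞
  choose z hz using hex
  obtain ⟨θu, hθu, -⟩ := exists_normedEllipticUnitFamily_of_reps F K h2 s hs ι e 𝔞 h𝔞 hN𝔞 z hz h155u
  exact ⟨θu, hθu⟩

end Summit.BirchSwinnertonDyer.Rank1Residual.Additive.GenusSeven

end
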